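import Mathlib
import HarnessLib
import Literature.Analysis.FluidPDE.KNSSSwirlTransport
import Literature.Analysis.FluidPDE.KNSSSwirlSupNonpos
import Literature.Analysis.FluidPDE.ClassicalSolutionRescale
import Summits.NavierStokesRegularity.NavierStokesRegularity.Theorems.HalfSpaceWindowDoorCirculationCarryingRigidityDefs

/-!
# Route `HalfSpaceWindowDoor`, crux `CirculationCarryingRigidity` (stmt-NavierStokesRegularity-25311) — the ONE-SIDED
# eddy-torque engine, part 1: swirl SUBSOLUTION pairs (signs, restriction, scaling covariance, supremum)

Line `eddy_torque` (LEAD ns-hsw-p1 g5; blueprint of g4, crux card `Lines/eddy_torque.md` §Next engine).  The landed census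
theorem `…EddyTorqueLiouville` needs the TWO-SIDED eddy bound `|ℛ| ≤ A/(r+√(−s))·∮ω₃ dl` because it runs KNSS's swirl Liouville
argument (Acta Math. 203 (2009), proof of Thm 5.3; g3's `…SourcedSwirl*`) whose plateau step, Lemma 2.1, is a statement about
SOLUTIONS.  The one-sided engine runs the same argument for the swirl SUBSOLUTION pairs of `…Defs.IsSubSwirl`:

  `∂ₜf ≤ Δf − Df[u] − (2/r)∂ᵣf + (A/r)∂ᵣf`,  `∂ₜf ≤ Δf − Df[u] − (2/r)∂ᵣf + (A/√(τ−t))∂ᵣf`,  `∂ᵣf ≥ 0`, `f|_{axis} = 0`, `|f| ≤ C_f`,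

with a divergence-free drift `r‖u‖ ≤ C_u`, plus joint smoothness and the scale-invariant gradient bound
`‖∇f‖ ≤ C_g(1/√(τ−t) + r/(τ−t))` (which is what lets positivity propagation for the supersolution `M − f` replace Lemma 2.1
WITHOUT exceptional sets: the rescaled scalars are uniformly Lipschitz on `s ≤ T − 1`).  This file: signs of the constants,
joint continuity, the time derivative, the collected radial form `∂ₜf ≤ Δf − Df[u] − ((2−A)/r)∂ᵣf` (`sub_radial'`), restriction
to earlier final times (`mono`), the scaling/translation covariance `rescale` (KNSS (5.11)–(5.13): all constants unchanged, final
time `T + (τ − t*)/λ²`) and the supremum with off-axis near-maxima (`exists_sup`).  Proofs follow the tree's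
`IsKNSSSwirlPair.rescale` / g3's `IsSourcedSwirl.rescale`, with the differential inequalities transported pointwise
(`deriv_comp_mul_left`, `laplacian_stPull`, `fderiv_stPull`).

Seat ns-hsw-p1 g5 (LEAD of 25311, cell pub-ns-dss).  WHAT THIS IS NOT: not a statement about Navier–Stokes regularity (Clay A); a
linear parabolic tool about HYPOTHETICAL blow-up profiles; no Liouville theorem in this file; helper `--supports` 25311.
-/

noncomputable section

-- the summit and its single sub-problem share the name (CONVENTIONS §1), as in every Theorems file
set_option linter.dupNamespace false

namespace Summit.NavierStokesRegularity.NavierStokesRegularity.Theorems.HalfSpaceWindowDoorCirculationCarryingRigiditySubSwirl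

open MeasureTheory Set Function Filter Topology TopologicalSpace InnerProductSpace WithLp Metric
open scoped Laplacian RealInnerProductSpace ContDiff
open Literature.Analysis Literature.Analysis.FluidPDE
open Summit.NavierStokesRegularity.NavierStokesRegularity.Theorems.HalfSpaceWindowDoorCirculationCarryingRigidityDefs

namespace IsSubSwirl

variable {Cf Cu Cg A τ : ℝ} {f : ℝ → (EuclideanSpace ℝ (Fin 3)) → ℝ}
  {u : ℝ → (EuclideanSpace ℝ (Fin 3)) → (EuclideanSpace ℝ (Fin 3))}

/-! ### Signs of the constants, joint continuity -/

/-- `C_f ≥ 0`. -/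
theorem Cf_nonneg (h : IsSubSwirl Cf Cu Cg A τ f u) : 0 ≤ Cf :=
  (abs_nonneg _).trans (h.abs_le (τ - 1) (by linarith) 0)

/-- `C_u ≥ 0`. -/
theorem Cu_nonneg (h : IsSubSwirl Cf Cu Cg A τ f u) : 0 ≤ Cu :=
  (mul_nonneg (cylRadius_nonneg _) (norm_nonneg _)).trans (h.drift_le (τ - 1) (by linarith) 0)

/-- `C_g ≥ 0` (the gradient bound at `t = τ − 1`, `x = 0` reads `0 ≤ ‖∇f‖ ≤ C_g`). -/
theorem Cg_nonneg (h : IsSubSwirl Cf Cu Cg A τ f u) : 0 ≤ Cg := by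
  have h1 := h.grad_le (τ - 1) (by linarith) 0
  have h0 : cylRadius (0 : EuclideanSpace ℝ (Fin 3)) = 0 := by simp [cylRadius]
  rw [h0, show τ - (τ - 1) = 1 by ring, Real.sqrt_one, zero_div, add_zero, div_one, mul_one] at h1
  exact (norm_nonneg _).trans h1

/-- The scalar is jointly smooth on the open slab (the field `smooth_joint`, in the tree's vocabulary). -/
theorem isSmoothSpaceTimeOn (h : IsSubSwirl Cf Cu Cg A τ f u) : IsSmoothSpaceTimeOn (Iio τ) f :=
  h.smooth_joint

/-- The drift is jointly smooth on the open slab. -/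
theorem isSmoothSpaceTimeOn_drift (h : IsSubSwirl Cf Cu Cg A τ f u) : IsSmoothSpaceTimeOn (Iio τ) u :=
  h.smooth_drift_joint

/-- **The scalar is jointly continuous** on `(−∞, τ) × ℝ³`. -/
theorem continuousOn_uncurry (h : IsSubSwirl Cf Cu Cg A τ f u) :
    ContinuousOn (uncurry f) (Iio τ ×ˢ univ) :=
  h.smooth_joint.continuousOn

/-- The scalar is jointly a.e.-strongly measurable on measurable subsets of the slab (restricted measures). -/
theorem aestronglyMeasurable_uncurry (h : IsSubSwirl Cf Cu Cg A τ f u)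
    {μ : Measure (ℝ × (EuclideanSpace ℝ (Fin 3)))} {S : Set (ℝ × (EuclideanSpace ℝ (Fin 3)))}
    (hS : MeasurableSet S) (hSτ : S ⊆ Iio τ ×ˢ univ) :
    AEStronglyMeasurable (uncurry f) (μ.restrict S) :=
  ((continuousOn_uncurry h).mono hSτ).aestronglyMeasurable hS

/-- The time slice map `t ↦ f t x` is smooth on `(−∞, τ)` for every `x`. -/
theorem contDiffOn_time (h : IsSubSwirl Cf Cu Cg A τ f u) (x : EuclideanSpace ℝ (Fin 3)) :
    ContDiffOn ℝ (⊤ : ℕ∞) (fun t => f t x) (Iio τ) := by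
  have hmaps : MapsTo (fun t : ℝ => ((t, x) : ℝ × EuclideanSpace ℝ (Fin 3))) (Iio τ) (Iio τ ×ˢ univ) :=
    fun t ht => ⟨ht, mem_univ _⟩
  have hg : ContDiff ℝ (⊤ : ℕ∞) fun t : ℝ => ((t, x) : ℝ × EuclideanSpace ℝ (Fin 3)) := by fun_prop
  exact h.smooth_joint.comp hg.contDiffOn hmaps

/-- The time slice map is differentiable at every `t < τ`, with derivative `deriv (f · x) t`. -/
theorem hasDerivAt_time (h : IsSubSwirl Cf Cu Cg A τ f u) {t : ℝ} (ht : t < τ) (x : EuclideanSpace ℝ (Fin 3)) :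
    HasDerivAt (fun σ => f σ x) (deriv (fun σ => f σ x) t) t :=
  (((contDiffOn_time h x).differentiableOn (by simp)).differentiableAt (Iio_mem_nhds ht)).hasDerivAt

/-- The two one-sided inequalities combine: with `a = A · min(1/r, 1/√(τ−t))`-type coefficients both hold; in particular the
radial form with the coefficient `(2 − A)/r` collected, the input format of the positivity bricks:
`∂ₜf ≤ Δf − Df[u] − ((2 − A)/r) ∂ᵣf`. -/
theorem sub_radial' (h : IsSubSwirl Cf Cu Cg A τ f u) {t : ℝ} (ht : t < τ) {x : EuclideanSpace ℝ (Fin 3)}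
    (hx : cylRadius x ≠ 0) :
    deriv (fun σ => f σ x) t ≤ (Δ (f t)) x - fderiv ℝ (f t) x (u t x) -
      (2 - A) / cylRadius x * fderiv ℝ (f t) x (eR x) := by
  have h1 := h.sub_radial t ht x hx
  rw [partialDeriv_apply] at h1
  have e : (Δ (f t)) x - fderiv ℝ (f t) x (u t x) - 2 / cylRadius x * fderiv ℝ (f t) x (eR x) +
      A / cylRadius x * fderiv ℝ (f t) x (eR x) =
      (Δ (f t)) x - fderiv ℝ (f t) x (u t x) - (2 - A) / cylRadius x * fderiv ℝ (f t) x (eR x) := by ring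
  linarith [h1, e.le, e.ge]

/-! ### Restriction to an earlier final time -/

/-- Restriction to an earlier final time (the time-form bounds `1/√(τ' − t) ≥ 1/√(τ − t)` only weaken the hypotheses, as
`∂ᵣf ≥ 0`, `A ≥ 0`, `C_g ≥ 0`). -/
theorem mono (h : IsSubSwirl Cf Cu Cg A τ f u) {τ' : ℝ} (hτ : τ' ≤ τ) : IsSubSwirl Cf Cu Cg A τ' f u where
  smooth t ht := h.smooth t (lt_of_lt_of_le ht hτ)
  smooth_joint := h.smooth_joint.mono (prod_mono (Iio_subset_Iio hτ) Subset.rfl)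
  continuousOn_fderiv := h.continuousOn_fderiv.mono (prod_mono (Iio_subset_Iio hτ) Subset.rfl)
  continuousOn_laplacian := h.continuousOn_laplacian.mono (prod_mono (Iio_subset_Iio hτ) Subset.rfl)
  axisymmetric t ht := h.axisymmetric t (lt_of_lt_of_le ht hτ)
  axis t ht := h.axis t (lt_of_lt_of_le ht hτ)
  abs_le t ht := h.abs_le t (lt_of_lt_of_le ht hτ)
  radial_nonneg t ht := h.radial_nonneg t (lt_of_lt_of_le ht hτ)
  grad_le t ht x := by
    have htτ : t < τ := lt_of_lt_of_le ht hτ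
    have hCg := Cg_nonneg h
    refine (h.grad_le t htτ x).trans (mul_le_mul_of_nonneg_left (add_le_add ?_ ?_) hCg)
    · exact one_div_le_one_div_of_le (Real.sqrt_pos.2 (by linarith)) (Real.sqrt_le_sqrt (by linarith))
    · exact div_le_div_of_nonneg_left (cylRadius_nonneg x) (by linarith) (by linarith)
  measurable_drift := h.measurable_drift
  smooth_drift t ht := h.smooth_drift t (lt_of_lt_of_le ht hτ)
  smooth_drift_joint := h.smooth_drift_joint.mono (prod_mono (Iio_subset_Iio hτ) Subset.rfl)
  divFree t ht := h.divFree t (lt_of_lt_of_le ht hτ)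
  drift_le t ht := h.drift_le t (lt_of_lt_of_le ht hτ)
  A_nonneg := h.A_nonneg
  sub_radial t ht x hx := h.sub_radial t (lt_of_lt_of_le ht hτ) x hx
  sub_time t ht x hx := by
    have htτ : t < τ := lt_of_lt_of_le ht hτ
    have h1 := h.sub_time t htτ x hx
    have hD : 0 ≤ partialDeriv (eR x) (f t) x := by
      rw [partialDeriv_apply]; exact h.radial_nonneg t htτ x
    have h2 : A / Real.sqrt (τ - t) ≤ A / Real.sqrt (τ' - t) :=
      div_le_div_of_nonneg_left h.A_nonneg (Real.sqrt_pos.2 (by linarith)) (Real.sqrt_le_sqrt (by linarith))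
    nlinarith [mul_le_mul_of_nonneg_right h2 hD]

/-! ### Scaling and translation covariance -/

/-- The preimage of the slab under the affine time map: `{s | t₀ + b s < τ} = (−∞, (τ − t₀)/b)` for `b > 0`. -/
theorem preimage_time_Iio {b t₀ τ : ℝ} (hb : 0 < b) :
    (fun r => t₀ + b * r) ⁻¹' Iio τ = Iio ((τ - t₀) / b) := by
  ext s
  simp only [mem_preimage, mem_Iio]
  rw [lt_div_iff₀ hb]
  constructor <;> intro h <;> linarith

/-- **Scaling and translation covariance** (KNSS (5.11)–(5.13), tree `IsKNSSSwirlPair.rescale` / g3 `IsSourcedSwirl.rescale`):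
with `Φ(s, y) = (t* − λ²T + λ² s, z̄ e_z + λ y)` the pair `(f ∘ Φ, λ (u ∘ Φ))` is a swirl subsolution pair with the SAME
constants up to the time `T + (τ − t*)/λ²`: the differential inequalities pick up the common factor `λ²`, the source
coefficients `A/r`, `A/√(τ−t)` and the gradient bound `C_g(1/√(τ−t) + r/(τ−t))` are scale-invariant. -/
theorem rescale (h : IsSubSwirl Cf Cu Cg A τ f u) {lam : ℝ} (hlam : 0 < lam) (tstar zbar T : ℝ) :
    IsSubSwirl Cf Cu Cg A (T + (τ - tstar) / lam ^ 2)
      (stPull (lam ^ 2) lam (tstar - lam ^ 2 * T) (zbar • eZ) f)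
      (lam • stPull (lam ^ 2) lam (tstar - lam ^ 2 * T) (zbar • eZ) u) := by
  set b : ℝ := lam ^ 2 with hb
  set t₀ : ℝ := tstar - lam ^ 2 * T with ht₀
  set x₀ : (EuclideanSpace ℝ (Fin 3)) := zbar • eZ with hx₀
  have hbpos : 0 < b := by positivity
  have hlam0 : lam ≠ 0 := hlam.ne'
  have hτ'eq : (τ - t₀) / b = T + (τ - tstar) / lam ^ 2 := by
    rw [ht₀, hb]; field_simp; ring
  have htime : ∀ s, s < T + (τ - tstar) / lam ^ 2 ↔ t₀ + b * s < τ := by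
    intro s
    rw [← hτ'eq, lt_div_iff₀ hbpos]
    constructor <;> intro hs <;> linarith
  have htimeeq : ∀ s, τ - (t₀ + b * s) = lam ^ 2 * (T + (τ - tstar) / lam ^ 2 - s) := by
    intro s; rw [ht₀, hb]; field_simp; ring
  have hX : ∀ y : (EuclideanSpace ℝ (Fin 3)), cylRadius (x₀ + lam • y) = lam * cylRadius y := fun y => by
    rw [hx₀, cylRadius_smul_eZ_add_smul, abs_of_pos hlam]
  have heRX : ∀ y : (EuclideanSpace ℝ (Fin 3)), eR (x₀ + lam • y) = eR y := fun y => eR_smul_eZ_add_smul zbar hlam y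
  have hΦc : Continuous fun p : ℝ × (EuclideanSpace ℝ (Fin 3)) => (t₀ + b * p.1, x₀ + lam • p.2) := by fun_prop
  have hΦmaps : MapsTo (fun p : ℝ × (EuclideanSpace ℝ (Fin 3)) => (t₀ + b * p.1, x₀ + lam • p.2))
      (Iio (T + (τ - tstar) / lam ^ 2) ×ˢ univ) (Iio τ ×ˢ univ) :=
    fun p hp => ⟨(htime p.1).1 hp.1, mem_univ _⟩
  -- the time derivative of the pulled-back scalar
  have hderiv : ∀ s (y : EuclideanSpace ℝ (Fin 3)),
      deriv (fun σ => stPull b lam t₀ x₀ f σ y) s = b * deriv (fun σ => f σ (x₀ + lam • y)) (t₀ + b * s) := by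
    intro s y
    have e : (fun σ => stPull b lam t₀ x₀ f σ y) = fun σ => (fun q => f (t₀ + q) (x₀ + lam • y)) (b * σ) := by
      funext σ; rfl
    rw [e, deriv_comp_mul_left b (fun q => f (t₀ + q) (x₀ + lam • y)) s, smul_eq_mul]
    congr 1
    exact deriv_comp_const_add (fun q => f q (x₀ + lam • y)) t₀ (b * s)
  -- the common computation behind the two inequalities: the KNSS part scales by `b = λ²`
  have hknss : ∀ s, s < T + (τ - tstar) / lam ^ 2 → ∀ y : EuclideanSpace ℝ (Fin 3), cylRadius y ≠ 0 →
      (Δ (stPull b lam t₀ x₀ f s)) y - fderiv ℝ (stPull b lam t₀ x₀ f s) y ((lam • stPull b lam t₀ x₀ u) s y) -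
        2 / cylRadius y * partialDeriv (eR y) (stPull b lam t₀ x₀ f s) y =
      b * ((Δ (f (t₀ + b * s))) (x₀ + lam • y) - fderiv ℝ (f (t₀ + b * s)) (x₀ + lam • y) (u (t₀ + b * s) (x₀ + lam • y)) -
        2 / cylRadius (x₀ + lam • y) * partialDeriv (eR (x₀ + lam • y)) (f (t₀ + b * s)) (x₀ + lam • y)) ∧
      partialDeriv (eR y) (stPull b lam t₀ x₀ f s) y =
        lam * partialDeriv (eR (x₀ + lam • y)) (f (t₀ + b * s)) (x₀ + lam • y) := by
    intro s hs y hy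
    have hs' : t₀ + b * s < τ := (htime s).1 hs
    have h2 : ContDiff ℝ 2 (f (t₀ + b * s)) := (h.smooth _ hs').of_le (by norm_cast)
    have hr : cylRadius y ≠ 0 := hy
    refine ⟨?_, ?_⟩
    · simp only [smul_stPull_apply]
      rw [laplacian_stPull b lam t₀ x₀ f s y h2, partialDeriv_apply, partialDeriv_apply, fderiv_stPull, heRX, hX]
      simp only [_root_.smul_apply, map_smul, smul_eq_mul, hb]
      field_simp
    · rw [partialDeriv_apply, partialDeriv_apply, fderiv_stPull, heRX, _root_.smul_apply, smul_eq_mul]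
  refine ⟨?_, ?_, ?_, ?_, ?_, ?_, ?_, ?_, ?_, ?_, ?_, ?_, ?_, ?_, h.A_nonneg, ?_, ?_⟩
  · intro s hs
    exact (h.smooth _ ((htime s).1 hs)).comp (contDiff_const.add (contDiff_const_smul lam))
  · -- joint smoothness
    have h1 := (isSmoothSpaceTimeOn h).smul_stPull 1 b lam t₀ x₀
    rw [one_smul, preimage_time_Iio hbpos, hτ'eq] at h1
    exact h1
  · have hc := (h.continuousOn_fderiv.comp hΦc.continuousOn hΦmaps).const_smul lam
    refine hc.congr fun p _ => ?_
    simp only [Pi.smul_apply, comp_apply]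
    exact fderiv_stPull b lam t₀ x₀ f p.1 p.2
  · have hc := (h.continuousOn_laplacian.comp hΦc.continuousOn hΦmaps).const_smul (lam ^ 2)
    refine hc.congr fun p hp => ?_
    have h2 : ContDiff ℝ 2 (f (t₀ + b * p.1)) :=
      (h.smooth _ ((htime p.1).1 hp.1)).of_le (by norm_cast)
    simp only [Pi.smul_apply, comp_apply, smul_eq_mul]
    rw [laplacian_stPull b lam t₀ x₀ f p.1 p.2 h2, smul_eq_mul]
  · intro s hs θ y
    simp only [stPull_apply]
    rw [hx₀, ← SereginSverak2009.rotZ_smul_eZ_add_smul, h.axisymmetric _ ((htime s).1 hs) θ]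
  · intro s hs y hy
    simp only [stPull_apply]
    exact h.axis _ ((htime s).1 hs) _ (by rw [hX, hy, mul_zero])
  · intro s hs y
    simp only [stPull_apply]
    exact h.abs_le _ ((htime s).1 hs) _
  · intro s hs y
    rw [fderiv_stPull b lam t₀ x₀ f s y, _root_.smul_apply, smul_eq_mul, ← heRX y]
    exact mul_nonneg hlam.le (h.radial_nonneg _ ((htime s).1 hs) _)
  · -- the gradient bound is scale-invariant
    intro s hs y
    have hs' := (htime s).1 hs
    rw [fderiv_stPull b lam t₀ x₀ f s y, norm_smul, Real.norm_eq_abs, abs_of_pos hlam]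
    have hg := h.grad_le _ hs' (x₀ + lam • y)
    have hCg := Cg_nonneg h
    have hpos : 0 < T + (τ - tstar) / lam ^ 2 - s := by linarith
    have hsq : Real.sqrt (τ - (t₀ + b * s)) = lam * Real.sqrt (T + (τ - tstar) / lam ^ 2 - s) := by
      rw [htimeeq s, Real.sqrt_mul (by positivity), Real.sqrt_sq hlam.le]
    rw [hsq, htimeeq s, hX] at hg
    have hsr : 0 < Real.sqrt (T + (τ - tstar) / lam ^ 2 - s) := Real.sqrt_pos.2 hpos
    have e : Cg * (1 / (lam * Real.sqrt (T + (τ - tstar) / lam ^ 2 - s)) +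
        lam * cylRadius y / (lam ^ 2 * (T + (τ - tstar) / lam ^ 2 - s))) =
        lam⁻¹ * (Cg * (1 / Real.sqrt (T + (τ - tstar) / lam ^ 2 - s) +
          cylRadius y / (T + (τ - tstar) / lam ^ 2 - s))) := by
      field_simp
    rw [e] at hg
    calc lam * ‖fderiv ℝ (f (t₀ + b * s)) (x₀ + lam • y)‖
        ≤ lam * (lam⁻¹ * (Cg * (1 / Real.sqrt (T + (τ - tstar) / lam ^ 2 - s) +
            cylRadius y / (T + (τ - tstar) / lam ^ 2 - s)))) := mul_le_mul_of_nonneg_left hg hlam.le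
      _ = Cg * (1 / Real.sqrt (T + (τ - tstar) / lam ^ 2 - s) + cylRadius y / (T + (τ - tstar) / lam ^ 2 - s)) := by
          field_simp
  · have hm : Measurable fun p : ℝ × (EuclideanSpace ℝ (Fin 3)) => (t₀ + b * p.1, x₀ + lam • p.2) := hΦc.measurable
    have hunc : uncurry (lam • stPull b lam t₀ x₀ u) =
        fun p : ℝ × (EuclideanSpace ℝ (Fin 3)) => lam • uncurry u (t₀ + b * p.1, x₀ + lam • p.2) := by
      funext p; rfl
    rw [hunc]
    exact (h.measurable_drift.comp hm).const_smul lam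
  · intro s hs
    have hu := h.smooth_drift _ ((htime s).1 hs)
    have hfun : (lam • stPull b lam t₀ x₀ u) s = fun y => lam • u (t₀ + b * s) (x₀ + lam • y) := by
      funext y; rfl
    rw [hfun]
    exact (hu.comp (contDiff_const.add (contDiff_const_smul lam))).const_smul lam
  · -- joint smoothness of the drift
    have h1 := (isSmoothSpaceTimeOn_drift h).smul_stPull lam b lam t₀ x₀
    rw [preimage_time_Iio hbpos, hτ'eq] at h1
    exact h1
  · intro s hs y
    have hfun : (lam • stPull b lam t₀ x₀ u) s = lam • stPull b lam t₀ x₀ u s := rfl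
    rw [hfun]
    have hd : DifferentiableAt ℝ (stPull b lam t₀ x₀ u s) y := by
      have hu := h.smooth_drift _ ((htime s).1 hs)
      exact ((hu.comp (contDiff_const.add (contDiff_const_smul lam))).differentiable (by simp)) y
    rw [VectorCalculus.divergence, fderiv_const_smul hd, ContinuousLinearMap.toLinearMap_smul,
      LinearMap.map_smul, smul_eq_mul]
    have := divergence_stPull b lam t₀ x₀ u s y
    rw [VectorCalculus.divergence] at this
    rw [this, h.divFree _ ((htime s).1 hs) _, mul_zero, mul_zero]
  · intro s hs y
    simp only [smul_stPull_apply, norm_smul, Real.norm_eq_abs, abs_of_pos hlam]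
    have hbd := h.drift_le _ ((htime s).1 hs) (x₀ + lam • y)
    rw [hX] at hbd
    nlinarith [hbd, cylRadius_nonneg y, norm_nonneg (u (t₀ + b * s) (x₀ + lam • y))]
  · -- the radial-form inequality
    intro s hs y hy
    have hs' := (htime s).1 hs
    have hyX : cylRadius (x₀ + lam • y) ≠ 0 := by rw [hX]; exact mul_ne_zero hlam0 hy
    obtain ⟨hK, hP⟩ := hknss s hs y hy
    have hsub := h.sub_radial _ hs' _ hyX
    rw [hderiv, hK, hP]
    have e : A / cylRadius y * (lam * partialDeriv (eR (x₀ + lam • y)) (f (t₀ + b * s)) (x₀ + lam • y)) =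
        b * (A / cylRadius (x₀ + lam • y) * partialDeriv (eR (x₀ + lam • y)) (f (t₀ + b * s)) (x₀ + lam • y)) := by
      rw [hX, hb]; field_simp
    rw [e]
    nlinarith [mul_le_mul_of_nonneg_left hsub hbpos.le]
  · -- the time-form inequality
    intro s hs y hy
    have hs' := (htime s).1 hs
    have hyX : cylRadius (x₀ + lam • y) ≠ 0 := by rw [hX]; exact mul_ne_zero hlam0 hy
    obtain ⟨hK, hP⟩ := hknss s hs y hy
    have hsub := h.sub_time _ hs' _ hyX
    rw [hderiv, hK, hP]
    have hpos : 0 < T + (τ - tstar) / lam ^ 2 - s := by linarith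
    have hsq : Real.sqrt (τ - (t₀ + b * s)) = lam * Real.sqrt (T + (τ - tstar) / lam ^ 2 - s) := by
      rw [htimeeq s, Real.sqrt_mul (by positivity), Real.sqrt_sq hlam.le]
    rw [hsq] at hsub
    have hsr : 0 < Real.sqrt (T + (τ - tstar) / lam ^ 2 - s) := Real.sqrt_pos.2 hpos
    have e : A / Real.sqrt (T + (τ - tstar) / lam ^ 2 - s) *
        (lam * partialDeriv (eR (x₀ + lam • y)) (f (t₀ + b * s)) (x₀ + lam • y)) =
        b * (A / (lam * Real.sqrt (T + (τ - tstar) / lam ^ 2 - s)) *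
          partialDeriv (eR (x₀ + lam • y)) (f (t₀ + b * s)) (x₀ + lam • y)) := by
      rw [hb]; field_simp
    rw [e]
    nlinarith [mul_le_mul_of_nonneg_left hsub hbpos.le]

/-! ### The supremum of `f` and near-maximum points off the axis -/

/-- The supremum `M = sup {f(t,x) : t < 0}` exists, dominates `f`, is approached, and if `f` takes a positive value then
`M > 0` and near-maximum points are off the axis (tree `IsKNSSSwirlPair.exists_sup`, verbatim). -/
theorem exists_sup (h : IsSubSwirl Cf Cu Cg A 0 f u) {t₀ : ℝ} (ht₀ : t₀ < 0)
    {x₀ : (EuclideanSpace ℝ (Fin 3))} (hpos : 0 < f t₀ x₀) :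
    ∃ M : ℝ, 0 < M ∧ M ≤ Cf ∧ (∀ t < 0, ∀ x, f t x ≤ M) ∧
      ∀ η > 0, ∃ t < 0, ∃ x, M - η < f t x ∧ (η ≤ M → cylRadius x ≠ 0) := by
  set S : Set ℝ := {v | ∃ t < 0, ∃ x, f t x = v} with hS
  have hbdd : BddAbove S := ⟨Cf, by rintro v ⟨t, ht, x, rfl⟩; exact (le_abs_self _).trans (h.abs_le t ht x)⟩
  have hne : S.Nonempty := ⟨f t₀ x₀, t₀, ht₀, x₀, rfl⟩
  refine ⟨sSup S, ?_, ?_, ?_, ?_⟩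
  · exact lt_of_lt_of_le hpos (le_csSup hbdd ⟨t₀, ht₀, x₀, rfl⟩)
  · exact csSup_le hne (by rintro v ⟨t, ht, x, rfl⟩; exact (le_abs_self _).trans (h.abs_le t ht x))
  · intro t ht x
    exact le_csSup hbdd ⟨t, ht, x, rfl⟩
  · intro η hη
    obtain ⟨v, ⟨t, ht, x, rfl⟩, hv⟩ := exists_lt_of_lt_csSup hne (by linarith : sSup S - η < sSup S)
    refine ⟨t, ht, x, hv, fun hηM hx => ?_⟩
    have h0 := h.axis t ht x hx
    have hM : 0 < sSup S := lt_of_lt_of_le hpos (le_csSup hbdd ⟨t₀, ht₀, x₀, rfl⟩)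
    linarith

end IsSubSwirl

end Summit.NavierStokesRegularity.NavierStokesRegularity.Theorems.HalfSpaceWindowDoorCirculationCarryingRigiditySubSwirl

end
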